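import Mathlib.RepresentationTheory.Homological.GroupCohomology.Functoriality
import Mathlib.GroupTheory.Coset.Basic
import Mathlib.GroupTheory.GroupAction.Quotient
import Mathlib.RingTheory.Adjoin.Basic
import Mathlib.Algebra.BigOperators.Group.Finset.Basic
import HarnessLib

/-!
# Cohomology of arithmetic quotients as group cohomology, with Hecke operators

Topic `NumberTheory/Automorphic`, namespace `Literature.NumberTheory.Automorphic.ArithmeticQuotient`.

Fix a group homomorphism `ι : Γ →* 𝒢` (in the applications `Γ = G(F)` the rational points of a
reductive group, `𝒢 = G(𝔸_{F,f})` its finite-adelic points, `ι` the diagonal embedding), a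
subgroup `L ≤ 𝒢` (a compact open "level" `K`) and a `k`-module of coefficients `M`.  The
(locally symmetric, "arithmetic") quotient of level `L` is
`X_L = Γ \ (X_∞ × 𝒢 ⧸ L)` with `X_∞` the (contractible) symmetric space; when `L` is not small
enough for `Γ` to act freely, `X_L` is regarded as the quotient *stack*, so that `X_{L'} → X_L`
is a covering of degree `[L : L']` (Scholze's convention, [Scholze2015, §V.4, before Thm. V.4.1]).
Since `X_∞` is contractible, the cohomology of this quotient stack is the `Γ`-equivariant
cohomology of the discrete `Γ`-set `𝒢 ⧸ L`, i.e. the **group cohomology**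

  `H^i(X_L, M) := H^i(Γ, Fun(𝒢 ⧸ L, M))`,   `(γ • f)(c) = f(ι(γ)⁻¹ c)`,

which by Shapiro's lemma is `⊕_{[x] ∈ Γ\𝒢/L} H^i(Γ ∩ x L x⁻¹, M)`, the familiar description of
`H^i(X_L, M)` as a sum of cohomology groups of congruence subgroups over the (finitely many, for
`G = GL_n`) connected components.  This file takes the displayed formula as the DEFINITION
(`ArithmeticQuotient.cohomology ι L M i`, Mathlib's `groupCohomology`), which makes the three
structures carried by these groups elementary and choice-free:

* **pull-back** along `X_{L'} → X_L` for `L' ≤ L` (`cohomologyPullback`): functoriality of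
  group cohomology in the coefficients along `f ↦ f ∘ (𝒢 ⧸ L' → 𝒢 ⧸ L)`;
* **change of coefficients** along a `k`-linear `φ : M → M'` (`cohomologyCoeffMap`);
* the **Hecke (double-coset) operators** `[L g L]`, `g ∈ 𝒢` (`heckeFun`, `heckeOperator`):
  on functions `(T_g f)(xL) = ∑_{hL ⊆ LgL} f(x h L)` (a finite sum when `L` and `gLg⁻¹` are
  commensurable, e.g. `L` compact open; junk value `0` otherwise), which commutes with the left
  `Γ`-action and hence acts on `H^i(X_L, M)` by functoriality — this is the usual action of the
  abstract Hecke algebra `k[L \ 𝒢 / L]` on `H^i(X_L, M)` ([Scholze2015, §V.4, "canonical action of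
  `𝕋_{F,S}` on `H^i(X_K, M_{ξ,K})`"]; [ShimuraIATAF1971, Ch. 3 and §8.3] for the double-coset
  formalism), with no restriction/corestriction needed;
* `heckeFun_one`: `T_1 = [L] = id`.

The Hecke algebras `𝕋(L, M, i)` generated by these operators, Hecke eigenclasses, and the
`p`-adically completed cohomology of a tower of levels (Emerton; Calegari–Emerton) with its big
Hecke algebra are built from these in `Literature.NumberTheory.Automorphic.CompletedCohomology`;
the case `G = GL_n` over a number field is `Literature.NumberTheory.Automorphic.CompletedCohomologyGL`.

Design notes. (1) Everything is over an arbitrary commutative ring `k` of coefficients (`ℤ`,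
`ℤ/p^t`, `ℤ_p`, `𝒪_E/ϖ^t`, …) so that Hecke eigenvalues `χ : 𝒢 → k` act on `H^i` directly.
(2) Mathlib's `groupCohomology` forces `k`, `Γ`, `𝒢`, `M` into one universe. (3) No topology is
used: compactness/openness of `L` only enter finiteness statements, not the definitions.
(4) NOT here: the comparison with singular cohomology of the manifold `X_L` for neat `L`, the
Hochschild–Serre/Shapiro decomposition over connected components, cup products, compactly
supported and Borel–Moore variants, and the corestriction (trace) maps.

## References

* P. Scholze, *On torsion in the cohomology of locally symmetric varieties*, Ann. of Math. 182
  (2015), §V.4 (locally symmetric spaces `X_K` of `GL_n/F` as stacks, Hecke algebras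
  `𝕋_{F,S}(K,ξ,i,m)`) [Scholze2015].
* F. Calegari, M. Emerton, *Completed cohomology — a survey*, in: Non-abelian fundamental groups
  and Iwasawa theory, LMS Lecture Note Ser. 393 (2012), 239–257, §§1, 5 [CalegariEmerton2011].
* G. Shimura, *Introduction to the arithmetic theory of automorphic functions* (1971), Ch. 3,
  §8.3 [ShimuraIATAF1971].
-/

noncomputable section

open CategoryTheory

universe u

namespace Literature.NumberTheory.Automorphic

namespace ArithmeticQuotient

variable (k : Type u) [CommRing k] {Γ 𝒢 : Type u} [Group Γ] [Group 𝒢]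

/-! ### The coefficient representation `Fun(𝒢 ⧸ L, M)` and the cohomology `H^i(X_L, M)` -/

section Coeff

variable (ι : Γ →* 𝒢) (L : Subgroup 𝒢) (M : Type u) [AddCommGroup M] [Module k M]

/-- The `k`-linear representation of `Γ` on the functions `𝒢 ⧸ L → M` by left translation
through `ι`: `(γ • f)(c) = f(ι(γ)⁻¹ • c)`.  Its `Γ`-invariants are the functions on the finite
(for `GL_n`) double coset space `Γ \ 𝒢 / L = π₀(X_L)`, i.e. `H⁰(X_L, M)`. [folklore] -/
def coeffRepresentation : Representation k Γ ((𝒢 ⧸ L) → M) where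
  toFun γ := LinearMap.funLeft k M fun c : 𝒢 ⧸ L => (ι γ)⁻¹ • c
  map_one' := by
    ext f c
    simp
  map_mul' γ γ' := by
    ext f c
    simp [mul_smul]

/-- Unfolding lemma: `(γ • f)(c) = f(ι(γ)⁻¹ • c)`. [folklore] -/
@[simp]
theorem coeffRepresentation_apply (γ : Γ) (f : (𝒢 ⧸ L) → M) (c : 𝒢 ⧸ L) :
    coeffRepresentation k ι L M γ f c = f ((ι γ)⁻¹ • c) :=
  rfl

/-- The coefficient object `Fun(𝒢 ⧸ L, M)` of level `L` in Mathlib's category `Rep k Γ`.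
[folklore] -/
abbrev coeffRep : Rep k Γ :=
  Rep.of (coeffRepresentation k ι L M)

/-- **Cohomology of the arithmetic quotient of level `L` with coefficients in `M`**:
`H^i(X_L, M) := H^i(Γ, Fun(𝒢 ⧸ L, M))` (group cohomology, Mathlib `groupCohomology`), the
cohomology of the quotient stack `Γ \ (X_∞ × 𝒢 ⧸ L)` for contractible `X_∞`; see the module
docstring.  For `Γ = GL_n(F) → 𝒢 = GL_n(𝔸_{F,f})` and `L = K` compact open this is
`H^i(X_K, M)` in the convention of [Scholze2015, §V.4]. [cite: Scholze2015, §V.4] -/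
abbrev cohomology (i : ℕ) : ModuleCat k :=
  groupCohomology (coeffRep k ι L M) i

end Coeff

/-! ### Pull-back along a change of level and change of coefficients -/

section Functoriality

variable (ι : Γ →* 𝒢) {L L' : Subgroup 𝒢} (M : Type u) [AddCommGroup M] [Module k M]

omit [Group Γ] in
variable {k ι M} in
/-- The projection `𝒢 ⧸ L' → 𝒢 ⧸ L` (`L' ≤ L`) is `𝒢`-equivariant. [folklore] -/
theorem quotientMapOfLE_smul (h : L' ≤ L) (a : 𝒢) (c : 𝒢 ⧸ L') :
    Subgroup.quotientMapOfLE h (a • c) = a • Subgroup.quotientMapOfLE h c := by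
  induction c using QuotientGroup.induction_on
  rfl

/-- Pull-back of functions along `𝒢 ⧸ L' → 𝒢 ⧸ L` for `L' ≤ L`, a morphism
`Fun(𝒢 ⧸ L, M) ⟶ Fun(𝒢 ⧸ L', M)` of `Γ`-representations. [folklore] -/
def pullbackHom (h : L' ≤ L) : coeffRep k ι L M ⟶ coeffRep k ι L' M :=
  Rep.ofHom ⟨LinearMap.funLeft k M (Subgroup.quotientMapOfLE h), fun γ =>
    LinearMap.ext fun f => funext fun c => by
      simp [quotientMapOfLE_smul]⟩

/-- Unfolding lemma for `pullbackHom`: `(pullback f)(c) = f(c̄)`. [folklore] -/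
@[simp]
theorem pullbackHom_apply (h : L' ≤ L) (f : (𝒢 ⧸ L) → M) (c : 𝒢 ⧸ L') :
    (pullbackHom k ι M h).hom f c = f (Subgroup.quotientMapOfLE h c) :=
  rfl

/-- **Pull-back in cohomology** `H^i(X_L, M) → H^i(X_{L'}, M)` along the covering
`X_{L'} → X_L`, `L' ≤ L` (functoriality of group cohomology in the coefficients). [folklore] -/
abbrev cohomologyPullback (h : L' ≤ L) (i : ℕ) : cohomology k ι L M i ⟶ cohomology k ι L' M i :=
  groupCohomology.map (MonoidHom.id Γ) (pullbackHom k ι M h) i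

variable {k M} (L) {M' : Type u} [AddCommGroup M'] [Module k M']

/-- Change of coefficients along a `k`-linear map `φ : M → M'`, a morphism
`Fun(𝒢 ⧸ L, M) ⟶ Fun(𝒢 ⧸ L, M')` of `Γ`-representations. [folklore] -/
def coeffHom (φ : M →ₗ[k] M') : coeffRep k ι L M ⟶ coeffRep k ι L M' :=
  Rep.ofHom ⟨φ.compLeft (𝒢 ⧸ L), fun _ => rfl⟩

/-- Unfolding lemma for `coeffHom`: `(φ_* f)(c) = φ (f c)`. [folklore] -/
@[simp]
theorem coeffHom_apply (φ : M →ₗ[k] M') (f : (𝒢 ⧸ L) → M) (c : 𝒢 ⧸ L) :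
    (coeffHom ι L φ).hom f c = φ (f c) :=
  rfl

/-- **Change of coefficients in cohomology** `H^i(X_L, M) → H^i(X_L, M')` along `φ : M → M'`.
[folklore] -/
abbrev cohomologyCoeffMap (φ : M →ₗ[k] M') (i : ℕ) :
    cohomology k ι L M i ⟶ cohomology k ι L M' i :=
  groupCohomology.map (MonoidHom.id Γ) (coeffHom ι L φ) i

variable {L}

/-- Pull-back and change of coefficients commute on the coefficient representations.
[folklore] -/
theorem coeffHom_comp_pullbackHom (h : L' ≤ L) (φ : M →ₗ[k] M') :
    coeffHom ι L φ ≫ pullbackHom k ι M' h = pullbackHom k ι M h ≫ coeffHom ι L' φ :=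
  Rep.hom_ext (Representation.IntertwiningMap.ext (LinearMap.ext fun _ => rfl))

/-- Pull-back and change of coefficients commute on `H^i`. [folklore] -/
theorem cohomologyCoeffMap_comp_cohomologyPullback (h : L' ≤ L) (φ : M →ₗ[k] M') (i : ℕ) :
    cohomologyCoeffMap ι L φ i ≫ cohomologyPullback k ι M' h i =
      cohomologyPullback k ι M h i ≫ cohomologyCoeffMap ι L' φ i := by
  rw [cohomologyCoeffMap, cohomologyPullback, ← groupCohomology.map_id_comp,
    coeffHom_comp_pullbackHom, groupCohomology.map_id_comp]

variable (k M)

/-- Pull-back along `L ≤ L` is the identity. [folklore] -/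
@[simp]
theorem pullbackHom_refl (L : Subgroup 𝒢) :
    pullbackHom k ι M (le_refl L) = 𝟙 (coeffRep k ι L M) := by
  refine Rep.hom_ext (Representation.IntertwiningMap.ext (LinearMap.ext fun f => funext fun c => ?_))
  induction c using QuotientGroup.induction_on
  rfl

/-- Pull-backs compose: `(L'' ≤ L') ∘ (L' ≤ L) = (L'' ≤ L)`. [folklore] -/
theorem pullbackHom_comp {L'' : Subgroup 𝒢} (h : L' ≤ L) (h' : L'' ≤ L') :
    pullbackHom k ι M h ≫ pullbackHom k ι M h' = pullbackHom k ι M (h'.trans h) := by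
  refine Rep.hom_ext (Representation.IntertwiningMap.ext (LinearMap.ext fun f => funext fun c => ?_))
  induction c using QuotientGroup.induction_on
  rfl

/-- Pull-back in cohomology along `L ≤ L` is the identity. [folklore] -/
@[simp]
theorem cohomologyPullback_refl (L : Subgroup 𝒢) (i : ℕ) :
    cohomologyPullback k ι M (le_refl L) i = 𝟙 (cohomology k ι L M i) := by
  rw [cohomologyPullback, pullbackHom_refl, groupCohomology.map_id]

/-- Pull-backs in cohomology compose. [folklore] -/
theorem cohomologyPullback_comp {L'' : Subgroup 𝒢} (h : L' ≤ L) (h' : L'' ≤ L') (i : ℕ) :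
    cohomologyPullback k ι M h i ≫ cohomologyPullback k ι M h' i =
      cohomologyPullback k ι M (h'.trans h) i := by
  rw [cohomologyPullback, cohomologyPullback, ← groupCohomology.map_id_comp, pullbackHom_comp]

end Functoriality

/-! ### Hecke operators -/

section Hecke

variable (L : Subgroup 𝒢) (g : 𝒢)

omit [Group Γ] in
variable {k} in
/-- The double coset `L g L` viewed inside `𝒢 ⧸ L`, i.e. the finite (for `L` compact open) set
`L g L / L` of left cosets it contains: the orbit of `gL` under `L`. [folklore] -/
def doubleCosetQuot : Set (𝒢 ⧸ L) :=
  MulAction.orbit L (g : 𝒢 ⧸ L)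

omit [Group Γ] in
variable {k L g} in
/-- `L g L / L` is stable under left multiplication by `L`. [folklore] -/
theorem coe_smul_mem_doubleCosetQuot {x : 𝒢 ⧸ L} (hx : x ∈ doubleCosetQuot L g) (l : L) :
    (l : 𝒢) • x ∈ doubleCosetQuot L g := by
  obtain ⟨m, rfl⟩ := hx
  refine ⟨l * m, ?_⟩
  show (l * m) • (g : 𝒢 ⧸ L) = (l : 𝒢) • m • (g : 𝒢 ⧸ L)
  rw [mul_smul]
  rfl

variable (M : Type u) [AddCommGroup M] [Module k M]

open scoped Classical in
omit [Group Γ] in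
/-- The **Hecke (double-coset) operator `[L g L]`** on functions `𝒢 ⧸ L → M`:
`(T_g f)(xL) = ∑_{hL ⊆ L g L} f(x h L)` (the sum over `d ∈ L g L / L` of `f(x • d)`, independent
of the representative `x` of `xL` since `L` permutes `L g L / L`).  Junk value: the zero map when
`L g L / L` is infinite (it is finite iff `L ∩ gLg⁻¹` has finite index in `L`, e.g. for `L`
compact open in a locally profinite `𝒢`).  This is the action of the characteristic function of
`L g L` in the Hecke algebra `k[L \ 𝒢 / L]`. [cite: ShimuraIATAF1971, Ch. 3, §3.1 and §8.3] -/
def heckeFun : ((𝒢 ⧸ L) → M) →ₗ[k] ((𝒢 ⧸ L) → M) where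
  toFun f c := if h : (doubleCosetQuot L g).Finite then ∑ d ∈ h.toFinset, f (c.out • d) else 0
  map_add' f f' := by
    ext c
    split_ifs <;> simp [Finset.sum_add_distrib]
  map_smul' r f := by
    ext c
    split_ifs <;> simp [Finset.smul_sum]

open scoped Classical in
omit [Group Γ] in
/-- Unfolding lemma for `heckeFun`. [folklore] -/
theorem heckeFun_apply (f : (𝒢 ⧸ L) → M) (c : 𝒢 ⧸ L) :
    heckeFun k L g M f c =
      if h : (doubleCosetQuot L g).Finite then ∑ d ∈ h.toFinset, f (c.out • d) else 0 :=
  rfl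

omit [Group Γ] in
variable {k L g M} in
/-- Re-indexing a sum over `L g L / L` by left multiplication with `l ∈ L`. [folklore] -/
theorem sum_doubleCosetQuot_coe_smul (h : (doubleCosetQuot L g).Finite) (l : L)
    (F : 𝒢 ⧸ L → M) : ∑ d ∈ h.toFinset, F ((l : 𝒢) • d) = ∑ d ∈ h.toFinset, F d := by
  refine Finset.sum_nbij' (fun d => (l : 𝒢) • d) (fun d => (l : 𝒢)⁻¹ • d) ?_ ?_ ?_ ?_
    fun _ _ => rfl
  · intro d hd
    rw [Set.Finite.mem_toFinset] at hd ⊢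
    exact coe_smul_mem_doubleCosetQuot hd l
  · intro d hd
    rw [Set.Finite.mem_toFinset] at hd ⊢
    simpa using coe_smul_mem_doubleCosetQuot hd l⁻¹
  · intro d _
    simp
  · intro d _
    simp

omit [Group Γ] in
/-- The trivial double coset: `L 1 L / L = {L}`. [folklore] -/
theorem doubleCosetQuot_one : doubleCosetQuot L (1 : 𝒢) = {((1 : 𝒢) : 𝒢 ⧸ L)} := by
  ext d
  simp only [Set.mem_singleton_iff, doubleCosetQuot]
  constructor
  · rintro ⟨m, rfl⟩
    show ((m : 𝒢) • ((1 : 𝒢) : 𝒢 ⧸ L)) = _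
    rw [MulAction.Quotient.smul_coe, smul_eq_mul, mul_one]
    exact QuotientGroup.eq.mpr (by simp)
  · rintro rfl
    exact MulAction.mem_orbit_self _

omit [Group Γ] in
/-- `T_1 = [L 1 L] = [L]` is the identity on `Fun(𝒢 ⧸ L, M)`. [folklore] -/
@[simp]
theorem heckeFun_one : heckeFun k L (1 : 𝒢) M = LinearMap.id := by
  classical
  have hfin : (doubleCosetQuot L (1 : 𝒢)).Finite := by
    rw [doubleCosetQuot_one]
    exact Set.finite_singleton _
  have hset : hfin.toFinset = {((1 : 𝒢) : 𝒢 ⧸ L)} :=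
    Finset.ext fun d => by rw [Set.Finite.mem_toFinset, doubleCosetQuot_one]; simp
  refine LinearMap.ext fun f => funext fun c => ?_
  rw [heckeFun_apply, dif_pos hfin, hset, Finset.sum_singleton, LinearMap.id_apply,
    MulAction.Quotient.smul_coe, smul_eq_mul, mul_one, QuotientGroup.out_eq']

variable (ι : Γ →* 𝒢)

/-- The Hecke operator `[L g L]` commutes with the left-translation action of `Γ` (left and
right multiplication commute). [cite: ShimuraIATAF1971, Ch. 3, §8.3] -/
theorem heckeFun_coeffRepresentation (γ : Γ) (f : (𝒢 ⧸ L) → M) :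
    heckeFun k L g M (coeffRepresentation k ι L M γ f) =
      coeffRepresentation k ι L M γ (heckeFun k L g M f) := by
  ext c
  simp only [heckeFun_apply, coeffRepresentation_apply]
  split_ifs with h
  · have hc : (ι γ)⁻¹ • c = (((ι γ)⁻¹ * c.out : 𝒢) : 𝒢 ⧸ L) := by
      conv_lhs => rw [← QuotientGroup.out_eq' c]
      rfl
    obtain ⟨l, hl⟩ := QuotientGroup.mk_out_eq_mul L ((ι γ)⁻¹ * c.out)
    rw [hc, hl]
    simp_rw [mul_smul]
    exact (sum_doubleCosetQuot_coe_smul h l fun d => f ((ι γ)⁻¹ • c.out • d)).symm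
  · rfl

/-- The Hecke operator `[L g L]` as an endomorphism of the `Γ`-representation `Fun(𝒢 ⧸ L, M)`.
[cite: ShimuraIATAF1971, Ch. 3, §8.3] -/
def heckeRepHom : coeffRep k ι L M ⟶ coeffRep k ι L M :=
  Rep.ofHom ⟨heckeFun k L g M, fun γ =>
    LinearMap.ext fun f => heckeFun_coeffRepresentation k L g M ι γ f⟩

/-- Unfolding lemma for `heckeRepHom`. [folklore] -/
@[simp]
theorem heckeRepHom_hom_apply (f : (𝒢 ⧸ L) → M) :
    (heckeRepHom k L g M ι).hom f = heckeFun k L g M f :=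
  rfl

/-- **The Hecke operator `T_g = [L g L]` on `H^i(X_L, M)`**, induced by functoriality of group
cohomology from the `Γ`-equivariant operator `heckeFun` on the coefficients `Fun(𝒢 ⧸ L, M)`;
this is the canonical action of the double coset `L g L` on the cohomology of the arithmetic
quotient of level `L` [Scholze2015, §V.4]. [cite: Scholze2015, §V.4] -/
abbrev heckeOperator (i : ℕ) : cohomology k ι L M i ⟶ cohomology k ι L M i :=
  groupCohomology.map (MonoidHom.id Γ) (heckeRepHom k L g M ι) i

/-- The Hecke operator `T_g` on `H^i(X_L, M)` as a `k`-linear endomorphism. [folklore] -/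
abbrev heckeEnd (i : ℕ) : Module.End k (cohomology k ι L M i) :=
  (heckeOperator k L g M ι i).hom

variable {k M} {M' : Type u} [AddCommGroup M'] [Module k M']

/-- Hecke operators commute with change of coefficients (on the coefficient representations).
[folklore] -/
theorem heckeRepHom_comp_coeffHom (φ : M →ₗ[k] M') :
    heckeRepHom k L g M ι ≫ coeffHom ι L φ = coeffHom ι L φ ≫ heckeRepHom k L g M' ι := by
  refine Rep.hom_ext (Representation.IntertwiningMap.ext (LinearMap.ext fun f => funext fun c => ?_))
  change φ (heckeFun k L g M f c) = heckeFun k L g M' (φ ∘ f) c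
  simp only [heckeFun_apply]
  split_ifs <;> simp

/-- Hecke operators commute with change of coefficients on `H^i`. [folklore] -/
theorem heckeOperator_comp_cohomologyCoeffMap (φ : M →ₗ[k] M') (i : ℕ) :
    heckeOperator k L g M ι i ≫ cohomologyCoeffMap ι L φ i =
      cohomologyCoeffMap ι L φ i ≫ heckeOperator k L g M' ι i := by
  rw [heckeOperator, cohomologyCoeffMap, ← groupCohomology.map_id_comp, heckeRepHom_comp_coeffHom,
    groupCohomology.map_id_comp]

end Hecke


end ArithmeticQuotient

end Literature.NumberTheory.Automorphic
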